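import Literature.MathematicalPhysics.QuantumFieldTheory.Balaban1983to89.Node00.TorusCoverLandau153RecDatumDoorGrad
import Summits.QuantumFields.YangMills.Theorems.BalabanUVNodesN07Thm4RecMemberOfCrown
import HarnessLib

/-!
# N07 [B11] (= [15] = [Balaban1985Variational]) Sect. F — **`HThm4RecMember152`: THE KNIT's MEMBER-ROW PREMISE WITH [15] (152) MEMBER 2 AT EVERY LEVEL ((T2b))**, and
# ★★★ `HThm4RecMember152 ⟸ DatumCrownAt` (pen (j-iii) of plan g93's WORD A3⁵ = ρ3 «φ-form», link 4)

Cell `pub-ymgap`, width seat `pub-ymgap-dag-n07-w3` g12.  `--kind definition --supports stmt-QuantumFields-20541 --as helper` (K0⁷; count-neutral).  ONE `def` (a displayed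
conclusion SHAPE) + theorems.  [6] = [Balaban1985RegularSpaces]; [15] = [Balaban1985Variational]; [III] = [Balaban1988Convergent]; [I] = [Balaban1987RG1].

WHY.  The ρ3 head's premise of record `HThm4RecSym152` (dag-n07-e) carries the conjunct (T2b) = print's (152) member 2 AS PRINTED, «(L^{j′}η)²|∇^η A| ≤ B·ε on □_{j′}» for
EVERY `j′`, whereas g11's `HThm4RecMember` (✓p721358) reads the gradient on the top box only (row 5).  The information sits in the crown (`DatumCrownAt`'s conjunct 8, all
levels); this seat's `_grad` door chain (`Node00/TorusCoverLandau153RecTower∕TowerDoor∕DatumDoorGrad`) exports it for the door's member gauge and reads it on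
`regionOfSet(π″□_{j′}).dpairs`.  THIS FILE names the strengthened shape and knits it from `DatumCrownAt` — ✓p721358's knit VERBATIM with the `_grad` door and ONE more row.

WHAT IS DECLARED ∕ PROVED.
* §1 `HThm4RecMember152 F N Mc ρ hρ κ a₀ : Prop` — `HThm4RecMember` VERBATIM with row 5′ «`∀ j′ ≤ j, ∀ q ∈ regionOfSet(π″ cube … j j′).dpairs, ‖grad η_j q.2.1 (A ⟨·,q.2.2⟩) q.1‖ <
  κ·ε_j·(L^{j−j′})²`» inserted after row 5 (displayed SHAPE, never asserted).
* §2 `hThm4RecMember_of_152` — the projection `HThm4RecMember152 → HThm4RecMember` (drop row 5′), so nothing keyed on ✓p721358 is orphaned.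
* §3 ★★★ `hThm4RecMember152_of_datumCrownAt (hρ) (hCr) (hcrown : DatumCrownAt …) (hκ : 4·Cr·L⁶ < κ) (hα : L³·a₀ ≤ α₁) (hwin) : HThm4RecMember152 F N Mc ρ hρ κ a₀` — SAME
  hypotheses as ✓p721358's knit; row 5′ from the `_grad` door's torus row `≤ 2·(Cr·L³·ε_{j−1})·((L^{j′}η_j)²)⁻¹` by `(L^{j′}η_j)⁻¹ = L^{j−j′}` and `two_mul_radius_mul_lt`.
HONEST FRAMING: count-neutral; composition by name + bookkeeping; `DatumCrownAt` is INHABITED for `N ≤ 25` (✓p739534∕✓p740700) so §3 yields `HThm4RecMember152` from the tree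
(next file: `…152OfRecordCrownSU`); the `Nrm` row 9′ (ρ3, sym currency) is NOT produced; `HThm4RecSym152` ∕ `HThm4Rec(Dbar)` UNDISCHARGED (caveat (C-S3-1)); N05 ∕ N07 NOT
discharged; K0⁷ ∕ K1⁹ NOT closed; counts unmoved (typed 28∕28 · discharged 8∕27); one finite 𝕋⁴ programme at fixed ε — R4 closes the conditional finite-𝕋⁴ rung
`BalabanLadder.UV` ONLY; the YM mass gap (Clay) is NOT proved by any of this; nothing continuum ∕ ℝ⁴ ∕ OS.  ONE `def`, no `instance`, no `notation`, no `sorry`.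

References: [6] Thm. 4 p. 88, Prop. 6 (1.130)–(1.138) pp. 98–99, (1.29) p. 81; [15] (144) p. 300, (147)–(153) p. 301, (152) p. 301; [III] p. 255, (2.13) p. 256; [I] (0.1) p. 251,
(0.3)–(0.4) pp. 252–253.
-/

set_option autoImplicit false

noncomputable section

open scoped BigOperators Matrix.Norms.L2Operator

namespace Summit.QuantumFields.YangMills.BalabanUVNodes.N07Thm4RecMember152OfCrown


open Literature.MathematicalPhysics.QuantumFieldTheory.Balaban1983to89
open Literature.MathematicalPhysics.QuantumFieldTheory.Balaban1983to89.Node00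
open Literature.MathematicalPhysics.QuantumFieldTheory.Balaban1983to89.B12RegularSpaces111 (gaugeU expI grad)
open B15Eq112TorusCover (cover)
open B14DomainGeom (Pt Within)
open B8Eq131Cubes (box cube tcube tLo tHi)
open B8Eq131CubesRec (boxZ cubeZ tcubeZ bLoZ bHiZ)
open B6SectADomainsV1 (Domains)
open B6SectAOperatorsV1 (RE dsE)
open B7Prop1Explicit (e gaugeAct)
open B7Prop1Local (AgreeOn)
open B7Prop2SpecialUnitary (specialUnitaryUnits)
open BlockAveragingZd (avgIterZ ctrShift)
open B8Ineq132 (covDerivFwd InAk)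
open B8Eq140Level (SideTouches)
open B8Eq138LandauZd (logCfg covLap)
open B8Eq138LandauZdRec (IsLandau138WZ)
open B8Eq119TwistedAxialRec (Restr129Z)
open B7SectEFLinearisationRec (logCovIterZ)
open B8Eq184Proof (cfgExp)
open B8ScaledSupNorm (msup bondNorm)
open B8Eq146AExpansion (plaqCovDeriv iEta)
open B8Eq143PlaqExpansion (pdiv)
open MatrixLog (mlog)
open Literature.MathematicalPhysics.QuantumFieldTheory.BalabanImbrieJaffe1984to88.BIJ85AxialPropagator411 (BondSpace)
open T4Continuum (T4Family)

variable (F : T4Family) (N : ℕ) [NeZero N]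
open N07Thm4RecMemberOfCrown (DatumCrownAt HThm4RecMember sitesPerDir_anti pow_mul_eta_inv_eq two_mul_radius_mul_lt)

/-! ## §1  The member-row premise with (152) member 2 at every level -/

/-- **`HThm4RecMember152` — g11's `HThm4RecMember` (✓p721358 :143) WITH [15] (152) MEMBER 2 AT EVERY LEVEL** (row 5′ «`∀ j′ ≤ j, ∀ q ∈ regionOfSet(π″ cube … j j′).dpairs,
‖grad η_j q.2.1 (A ⟨·, q.2.2⟩) q.1‖ < κ·ε_j·(L^{j−j′})²`» inserted after row 5; every other binder and row BYTE FOR BYTE).  A displayed conclusion SHAPE; the projection to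
`HThm4RecMember` is `hThm4RecMember_of_152`; the ρ3 head `HThm4RecSym152` (dag-n07-e) reads rows 1–8 + 5′ from it.
[cite: Balaban1985Variational, (152) p.301, (147)–(153) p.301; Balaban1985RegularSpaces, Thm. 4 p.88, Prop. 6 (1.130)–(1.138) p.99, (1.29) p.81; Balaban1987RG1, (0.4) p.253] -/
def HThm4RecMember152 (Mc ρ : ℕ) (hρ : F.L ≤ ρ) (κ a₀ : ℝ) : Prop :=
  0 < κ → ∀ (ν : Stage7Numerics) (M : ℕ) (g : ℕ → ℝ) (K k : ℕ) (s : SeqOfRecord F ν M g K k), Sect2.SeqSeparated ν.M₁ s → 0 < ν.M₁ →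
    (11 * 4 + 4 * ρ + Mc + 3) * F.L ≤ ν.M₁ → Mc + 11 * 4 + 6 * ρ ≤ (F.P K).sitesPerDir k → 1 ≤ k →
    ∀ (ε : ℕ → ℝ), (∀ n, n ≤ k → 0 < ε n ∧ ε n ≤ a₀) → (∀ n, n < k → ε n ≤ 2 * ε (n + 1)) →
    ∀ U : GaugeField (F.P K) 0 (SU N),
    (∀ n, n ≤ k → PlaqSmallOn (Sect2.omegaPlaqsTop s.Ω (suppDomOfRecord F ν K s.Ω) n) (ε n * (F.P K).eta n ^ 2) U) →
    (∀ n, n ≤ k → Sect2.CoDivSmallOn (Sect2.omegaBondsTop s.Ω (suppDomOfRecord F ν K s.Ω) n) (ε n * (F.P K).eta n ^ 3) U) →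
    ∀ (j : ℕ) (hk : j ≤ (F.P K).m + (F.P K).K) (hj : 1 ≤ j), j ≤ k → ∀ (idx : Pt (F.P K).d),
    (∃ x ∈ box (F.P K).L (cornerP (F.P K) Mc ρ idx) (sideP (F.P K) Mc ρ) j, ∃ y : Pt (F.P K).d, cover (F.P K) y ∈ s.Ω j ∧ Within ((3 : ℕ) : ℤ) x y) →
    letI : CStarAlgebra (MatA N) := {};
    ∃ (u : GaugeTransf (F.P K) 0 (SU N)) (A : PBond (F.P K) 0 → MatA N),
      (∀ b ∈ (Sect2.regionOfSet (F.P K) (cover (F.P K) '' box (F.P K).L (cornerP (F.P K) Mc ρ idx) (sideP (F.P K) Mc ρ) j)).bonds,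
        gaugeU (fun x => ιSU N (u x)) (fun b' => ιSU N (U b')) b = expI ((F.P K).eta j) (A b)) ∧
      (∀ b ∈ (Sect2.regionOfSet (F.P K) (cover (F.P K) '' cube (F.P K).L (cornerP (F.P K) Mc ρ idx) (sideP (F.P K) Mc ρ) ρ j 0)).bonds,
        gaugeU (fun x => ιSU N (u x)) (fun b' => ιSU N (U b')) b = expI ((F.P K).eta j) (A b)) ∧
      (∀ j', j' ≤ j →
        ∀ b ∈ (Sect2.regionOfSet (F.P K) (cover (F.P K) '' cube (F.P K).L (cornerP (F.P K) Mc ρ idx) (sideP (F.P K) Mc ρ) ρ j j')).bonds,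
          ‖A b‖ < κ * ε j * ((F.P K).L : ℝ) ^ (j - j')) ∧
      (∀ b ∈ (Sect2.regionOfSet (F.P K) (cover (F.P K) '' box (F.P K).L (cornerP (F.P K) Mc ρ idx) (sideP (F.P K) Mc ρ) j)).bonds,
        ‖A b‖ < κ * ε j) ∧
      (∀ q ∈ (Sect2.regionOfSet (F.P K) (cover (F.P K) '' box (F.P K).L (cornerP (F.P K) Mc ρ idx) (sideP (F.P K) Mc ρ) j)).dpairs,
        ‖grad ((F.P K).eta j) q.2.1 (fun y => A ⟨y, q.2.2⟩) q.1‖ < κ * ε j) ∧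
      -- ★ row 5′ = (T2b): [15] (152) member 2 AT EVERY LEVEL `j′ ≤ j` of the cube tower, `(L^{j′}η_j)²|∇^{η_j} A| ≤ …` read as `< κ·ε_j·(L^{j−j′})²`
      (∀ j', j' ≤ j → ∀ q ∈ (Sect2.regionOfSet (F.P K) (cover (F.P K) '' cube (F.P K).L (cornerP (F.P K) Mc ρ idx) (sideP (F.P K) Mc ρ) ρ j j')).dpairs,
        ‖grad ((F.P K).eta j) q.2.1 (fun y => A ⟨y, q.2.2⟩) q.1‖ < κ * ε j * (((F.P K).L : ℝ) ^ (j - j')) ^ 2) ∧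
      (∀ b ∈ Sect2.bondsDeep (cover (F.P K) '' box (F.P K).L (cornerP (F.P K) Mc ρ idx) (sideP (F.P K) Mc ρ) j),
        ‖Sect2.codiffCurlA ((F.P K).eta j) A b.src b.dir‖ < κ * ε j) ∧
      (∀ b ∈ Sect2.bondsDeep (cover (F.P K) '' box (F.P K).L (cornerP (F.P K) Mc ρ idx) (sideP (F.P K) Mc ρ) j),
        ‖∑ ν' : Fin (F.P K).d, (((F.P K).eta j : ℝ) : ℂ)⁻¹ •
            (grad ((F.P K).eta j) ν' (fun y => A ⟨y, b.dir⟩) (b.src.unshift ν') - grad ((F.P K).eta j) ν' (fun y => A ⟨y, b.dir⟩) b.src)‖ < κ * ε j) ∧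
      (∀ φ : MatA N →L[ℂ] ℂ,
        RE (domainsMeet (cubeDomains (F.P K) (cornerP (F.P K) Mc ρ idx) (sideP (F.P K) Mc ρ) ρ j hk) (domainsOfSeq s.Ω j hk)) ((F.P K).eta j)⁻¹
            (dsE ((F.P K).eta j)⁻¹ (WithLp.toLp 2 fun b => (φ (A b)).re : BondSpace (F.P K))) = 0 ∧
        RE (domainsMeet (cubeDomains (F.P K) (cornerP (F.P K) Mc ρ idx) (sideP (F.P K) Mc ρ) ρ j hk) (domainsOfSeq s.Ω j hk)) ((F.P K).eta j)⁻¹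
            (dsE ((F.P K).eta j)⁻¹ (WithLp.toLp 2 fun b => (φ (A b)).im : BondSpace (F.P K))) = 0) ∧
      ∃ um : B7Prop1Explicit.Site (F.P K).d → (MatA N)ˣ,
      (∀ x, x ∈ tcubeZ (F.P K).L (cornerP (F.P K) Mc ρ idx) (sideP (F.P K) Mc ρ) ρ j → ∀ μ,
          A ⟨cover (F.P K) (x + fun _ => (ctrShift (F.P K).L j : ℤ)), μ⟩ =
            logCfg ((F.P K).eta j) ((propCubePZ (F.P K) j hj Mc ρ hρ idx).fixed
              (fun x μ => ιSU N (U ⟨cover (F.P K) (x + fun _ => (ctrShift (F.P K).L j : ℤ)), μ⟩)) um) x μ) ∧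
      (∀ x, x ∈ (propCubePZ (F.P K) j hj Mc ρ hρ idx).sq 0 →
          ιSU N (u (cover (F.P K) (x + fun _ => (ctrShift (F.P K).L j : ℤ)))) =
            (um x)⁻¹ * (propCubePZ (F.P K) j hj Mc ρ hρ idx).vfix (fun x μ => ιSU N (U ⟨cover (F.P K) (x + fun _ => (ctrShift (F.P K).L j : ℤ)), μ⟩)) x) ∧
      (∀ x, um x ∈ specialUnitaryUnits (Fin N)) ∧ (∀ x, x ∉ (propCubePZ (F.P K) j hj Mc ρ hρ idx).sq 0 → um x = 1) ∧
      Restr129Z (F.P K).L j (propCubePZ (F.P K) j hj Mc ρ hρ idx).lamS (1 : B7Prop1Explicit.Site (F.P K).d → Fin (F.P K).d → (MatA N)ˣ) um ∧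
      (∀ (x : B7Prop1Explicit.Site (F.P K).d) (μ : Fin (F.P K).d),
        bLoZ (F.P K).L (cornerP (F.P K) Mc ρ idx) 0 0 ≤ x → x + e μ ≤ bHiZ (F.P K).L (cornerP (F.P K) Mc ρ idx) (sideP (F.P K) Mc ρ) 0 0 →
        (propCubePZ (F.P K) j hj Mc ρ hρ idx).inTop x → (propCubePZ (F.P K) j hj Mc ρ hρ idx).inTop (x + e μ) →
        logCovIterZ (F.P K).L (1 : B7Prop1Explicit.Site (F.P K).d → Fin (F.P K).d → (MatA N)ˣ)
            (iEta ((F.P K).eta j) ((propCubePZ (F.P K) j hj Mc ρ hρ idx).expo ((F.P K).eta j)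
              (fun x μ => ιSU N (U ⟨cover (F.P K) (x + fun _ => (ctrShift (F.P K).L j : ℤ)), μ⟩)) um)) j x μ =
          mlog ((avgIterZ (F.P K).L ((propCubePZ (F.P K) j hj Mc ρ hρ idx).axial
            (fun x μ => ιSU N (U ⟨cover (F.P K) (x + fun _ => (ctrShift (F.P K).L j : ℤ)), μ⟩))) j x μ : (MatA N)ˣ) : MatA N))

variable {F N}

/-! ## §2  Projection to `HThm4RecMember` -/

/-- The projection `HThm4RecMember152 → HThm4RecMember` (drop row 5′). [cite: Balaban1985Variational, (152) p.301 (bookkeeping)] -/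
theorem hThm4RecMember_of_152 {Mc ρ : ℕ} {hρ : F.L ≤ ρ} {κ a₀ : ℝ} (h : HThm4RecMember152 F N Mc ρ hρ κ a₀) : HThm4RecMember F N Mc ρ hρ κ a₀ := by
  intro hκ ν M g K k s hsep hM₁ hfl hnw hk1 ε hε hcomp U hP hD j hk hj1 hjk idx hmeet
  obtain ⟨u, A, h1, h2, h3, h4, h5, -, h6, h7, h8, hm⟩ := h hκ ν M g K k s hsep hM₁ hfl hnw hk1 ε hε hcomp U hP hD j hk hj1 hjk idx hmeet
  exact ⟨u, A, h1, h2, h3, h4, h5, h6, h7, h8, hm⟩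

/-! ## §3  The knit: `HThm4RecMember152 ⟸ DatumCrownAt` -/

/-- ★★★ **`HThm4RecMember152` ⟸ `DatumCrownAt`** — ✓p721358's `hThm4RecMember_of_datumCrownAt` VERBATIM over the `_grad` door
(`Node00.exists_datumGauge152_153_member_of_crownAt_grad`), plus row 5′: the door's torus row `‖grad‖ ≤ 2·(Cr·L³·ε_{j−1})·((L^{j′}η_j)²)⁻¹` turned STRICT `< κ·ε_j·(L^{j−j′})²` by
`(L^{j′}η_j)⁻¹ = L^{j−j′}` (`pow_mul_eta_inv_eq`) and the budget `2·Cr·L³·ε_{j−1} < κ·ε_j` (`two_mul_radius_mul_lt`, `ε_{j−1} ≤ 2ε_j`, `κ > 4·Cr·L⁶`).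
[cite: Balaban1985RegularSpaces, Thm. 4 p.88, Prop. 6 (1.130)–(1.138) p.99, p.98, (1.7)–(1.9) p.77, (1.29) p.81; Balaban1985Variational, (144) p.300, (147)–(153) p.301, (152) p.301; Balaban1988Convergent, p.255, (2.13) p.256; Balaban1987RG1, (0.1) p.251, (0.3)–(0.4) pp.252–253] -/
theorem hThm4RecMember152_of_datumCrownAt {Mc ρ : ℕ} (hρ : F.L ≤ ρ) {Cr α₁ κ a₀ : ℝ} (hCr : 0 ≤ Cr) (hcrown : DatumCrownAt F N Mc ρ hρ Cr α₁)
    (hκ : 4 * Cr * (F.L : ℝ) ^ 6 < κ) (hα : (F.L : ℝ) ^ 3 * a₀ ≤ α₁) (hwin : 4 * ((N : ℝ) * (Cr * ((F.L : ℝ) ^ 3 * a₀))) < 2 * Real.pi) :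
    HThm4RecMember152 F N Mc ρ hρ κ a₀ := by
  intro _ ν M g K k s hsep hM₁ hfl hnw hk1 ε hε hcomp U hP hD j hk hj1 hjk idx hmeet
  letI : CStarAlgebra (MatA N) := {}
  have hL2 : 2 ≤ F.L := (F.P 0).hL.2
  have hL1 : (1 : ℝ) ≤ F.L := by exact_mod_cast (F.P 0).L_pos
  have hd : 2 ≤ (F.P K).d := by rw [T4Family.P_d]; norm_num
  have hρ' : (F.P K).L ≤ ρ := by rw [T4Family.P_L]; exact hρ
  -- (d) the tolerances at the datum
  have hεj1 : 0 < ε (j - 1) := (hε (j - 1) (by omega)).1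
  have hεj1a : ε (j - 1) ≤ a₀ := (hε (j - 1) (by omega)).2
  have hεj : 0 < ε j := (hε j hjk).1
  have hε2 : ε (j - 1) ≤ 2 * ε j := by
    have := hcomp (j - 1) (by omega)
    rwa [show j - 1 + 1 = j by omega] at this
  have hL3 : (0 : ℝ) < (F.L : ℝ) ^ 3 := by positivity
  have hαpos : 0 < ((F.P K).L : ℝ) ^ 3 * ε (j - 1) := by rw [T4Family.P_L]; exact mul_pos hL3 hεj1
  have hαle : ((F.P K).L : ℝ) ^ 3 * ε (j - 1) ≤ α₁ := by
    rw [T4Family.P_L]; exact (mul_le_mul_of_nonneg_left hεj1a hL3.le).trans hα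
  have h4 : 4 * ((N : ℝ) * (Cr * (((F.P K).L : ℝ) ^ 3 * ε (j - 1)))) < 2 * Real.pi := by
    rw [T4Family.P_L]
    refine lt_of_le_of_lt ?_ hwin
    have hN : (0 : ℝ) ≤ N := Nat.cast_nonneg N
    gcongr
  -- (c) the non-wrapping of `□̃` from the guard (`sitesPerDir` antitone)
  have hg : Mc + 11 * (F.P K).d + 6 * ρ ≤ (F.P K).sitesPerDir j := by
    rw [T4Family.P_d]
    exact hnw.trans (sitesPerDir_anti (F.P K) hjk)
  have hinj := injOn_cover_tcube_of_guard (P := F.P K) (a := idx) hk hg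
  -- (b) the collar inclusion from the meeting witness
  obtain ⟨x, hx, y, hy, hxy⟩ := hmeet
  have hM₁1 : 1 ≤ ν.M₁ := hM₁
  have hcollar : cover (F.P K) '' tcube (F.P K).L (cornerP (F.P K) Mc ρ idx) (sideP (F.P K) Mc ρ) ρ j ⊆
      (if j - 1 = 0 then suppDomOfRecord F ν K s.Ω else s.Ω (j - 1)) := by
    rcases Nat.lt_or_ge j 2 with hj2 | hj2
    · have hj1' : j = 1 := by omega
      subst hj1'
      rw [if_pos rfl, suppDomOfRecord_eq]
      rintro _ ⟨z, hz, rfl⟩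
      have hz' : z ∈ (cubeIdxP' (F.P K) 1 le_rfl Mc ρ idx).Ω 0 := by rw [cubeIdxP'_Ω]; exact hz
      have hw := within_of_mem_Ω_cubeIdxP'_of_within_box (P := F.P K) le_rfl hx hxy hz'
      refine cover_mem_hullD_one_of_within hM₁ hy (hw.mono ?_)
      rw [B14.Eq213MaximalDomains.side, pow_one, T4Family.P_d, T4Family.P_L]
      have hf : (((11 * 4 + 4 * ρ + Mc + 3) * F.L : ℕ) : ℤ) ≤ ν.M₁ := by exact_mod_cast hfl
      have hL1z : (1 : ℤ) ≤ F.L := by exact_mod_cast (F.P 0).L_pos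
      push_cast at hf ⊢
      nlinarith
    · rw [if_neg (by omega)]
      have hfloor : 11 * (F.P K).d + 4 * ρ + Mc + 3 ≤ ν.M₁ := by
        rw [T4Family.P_d]
        exact le_trans (Nat.le_mul_of_pos_right _ (F.P 0).L_pos) hfl
      have h := Sect2.cover_image_Ω_cubeIdxP'_subset_of_within_mem_box (P := F.P K) hM₁1 s hsep hfloor hj2 hjk hx hy hxy 0
      rwa [cubeIdxP'_Ω] at h
  -- (a) the crown at the datum, at the one tolerance `α_j = L³·ε_{j−1}`
  have hP6 := hcrown K U j hj1 idx (((F.P K).L : ℝ) ^ 3 * ε (j - 1)) hαpos hαle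
  -- the door
  obtain ⟨u, A, um, h1, hlev, hbox, hgrad, hcurl, hsum, hRE, hA7, hsid, hsu, hoff, h129, h137, hgradAll⟩ :=
    exists_datumGauge152_153_member_of_crownAt_grad (P := F.P K) (N := N) hd hj1 hk hρ' idx U hP hD (by omega) hεj1 hcollar hCr hP6 hinj h4
  -- the strict-row budget at this datum
  have hLK : (1 : ℝ) ≤ ((F.P K).L : ℝ) := by rw [T4Family.P_L]; exact hL1
  have hκ' : 4 * Cr * ((F.P K).L : ℝ) ^ 6 < κ := by rw [T4Family.P_L]; exact hκ
  have hrow : ∀ t : ℝ, 0 ≤ t → t ≤ ((F.P K).L : ℝ) ^ 3 → 2 * ((Cr * (((F.P K).L : ℝ) ^ 3 * ε (j - 1))) * t) < κ * ε j :=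
    fun t ht htL => two_mul_radius_mul_lt hLK hCr hκ' hεj hε2 ht htL
  have hL0 : (0 : ℝ) ≤ ((F.P K).L : ℝ) := Nat.cast_nonneg _
  have hLpow : ∀ i : ℕ, i ≤ 3 → ((F.P K).L : ℝ) ^ i ≤ ((F.P K).L : ℝ) ^ 3 := fun i hi => pow_le_pow_right₀ hLK hi
  refine ⟨u, A, ?_, h1, ?_, ?_, ?_, ?_, ?_, ?_, fun φ => hRE (domainsOfSeq s.Ω j hk) φ, um, hA7, hsid, hsu, hoff, h129, h137⟩
  · -- row 1: the box lies in `□₀`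
    intro b hb
    exact h1 b (Sect2.regionOfSet_bonds_mono (Set.image_mono (B8Eq131Cubes.box_subset_cube (Nat.zero_le j))) hb)
  · -- row 3: the level letters, `(L^{j′}η_j)⁻¹ = L^{j−j′}`
    intro j' hj' b hb
    have h := hlev j' hj' b hb
    rw [pow_mul_eta_inv_eq (F.P K) hj'] at h
    refine h.trans_lt ?_
    have hpos : (0 : ℝ) < ((F.P K).L : ℝ) ^ (j - j') := by positivity
    have := hrow 1 zero_le_one (by simpa using hLpow 0 (by norm_num))
    rw [mul_one] at this
    calc 2 * (Cr * (((F.P K).L : ℝ) ^ 3 * ε (j - 1)) * ((F.P K).L : ℝ) ^ (j - j'))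
        = 2 * (Cr * (((F.P K).L : ℝ) ^ 3 * ε (j - 1))) * ((F.P K).L : ℝ) ^ (j - j') := by ring
      _ < κ * ε j * ((F.P K).L : ℝ) ^ (j - j') := mul_lt_mul_of_pos_right this hpos
  · -- row 4
    intro b hb
    exact (hbox b hb).trans_lt (hrow _ hL0 (by simpa using hLpow 1 (by norm_num)))
  · -- row 5
    intro q hq
    exact (hgrad q hq).trans_lt (hrow _ (by positivity) (hLpow 2 (by norm_num)))
  · -- row 5′ = (T2b): `((L^{j′}η_j)²)⁻¹ = (L^{j−j′})²`
    intro j' hj' q hq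
    have h := hgradAll j' hj' q hq
    rw [← inv_pow, pow_mul_eta_inv_eq (F.P K) hj'] at h
    refine h.trans_lt ?_
    have hpos : (0 : ℝ) < (((F.P K).L : ℝ) ^ (j - j')) ^ 2 := by positivity
    have := hrow 1 zero_le_one (by simpa using hLpow 0 (by norm_num))
    rw [mul_one] at this
    calc 2 * (Cr * (((F.P K).L : ℝ) ^ 3 * ε (j - 1)) * (((F.P K).L : ℝ) ^ (j - j')) ^ 2)
        = 2 * (Cr * (((F.P K).L : ℝ) ^ 3 * ε (j - 1))) * (((F.P K).L : ℝ) ^ (j - j')) ^ 2 := by ring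
      _ < κ * ε j * (((F.P K).L : ℝ) ^ (j - j')) ^ 2 := mul_lt_mul_of_pos_right this hpos
  · -- row 6
    intro b hb
    exact (hcurl b hb).trans_lt (hrow _ (by positivity) le_rfl)
  · -- row 7
    intro b hb
    exact (hsum b hb).trans_lt (hrow _ (by positivity) le_rfl)

end Summit.QuantumFields.YangMills.BalabanUVNodes.N07Thm4RecMember152OfCrown

end

/-! ## Axiom audit (gate whitelist: `propext`, `Classical.choice`, `Quot.sound`) -/
#print axioms Summit.QuantumFields.YangMills.BalabanUVNodes.N07Thm4RecMember152OfCrown.hThm4RecMember152_of_datumCrownAt
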